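import Mathlib
import Literature.NumberTheory.LFunctions.Zhang2022.Section13U007b
import Literature.NumberTheory.LFunctions.Zhang2022.Section13ChainClosed
import HarnessLib

/-!
# Zhang (2022) §13, (13.11): the `L·B` mean values (I3-L) from Lemma 6.1 — the EDGE
# `Σ_{ψ}|L(w,ψ)B_i(s,ψ)|² ⇐ {Σ|K·B_i|², Σ|N·B_i|², Σ E₁²|B_i|², Σ|B_i|²}`, kernel-checked

Topic `Literature/NumberTheory/LFunctions/Zhang2022` (Landau–Siegel audit tree; verdict-neutral).
Y. Zhang, *Discrete mean estimates and the Landau–Siegel zero*, arXiv:2211.02515v1 (2022)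
[Zhang2022LandauSiegel] — **an unrefereed manuscript under adjudication; nothing here asserts or denies
its Theorems 1–2.** ZHANG-L discharge lane, WP14 §13 programme (leaf h1311
`Skeleton.Eq1311Rel c′ c137`, GAP G-L3t6-3: "(13.11) `𝔈 = o(𝔓)` … Combining (2.34), Cauchy's
inequality, Proposition 7.1, Lemma 5.9, 6.1 and 3.3, we can verify", p. 75, tex L3806–L3817 — not
carried out in print). WP14-PLAN v1 §3 item **I3-L** (mean values of `L(w,ψ)·B_i(s,ψ)` on the strip;
signatures `meanSq_L_mul_B1_le` / `meanSq_L_mul_B2_le` of zl-w14-typer's scratch, VERBATIM conclusions).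

This file is the EDGE that reduces I3-L to the other mean values of the programme, exactly as the
scratch prescribes ("I3-L ⇐ (K·B_i, N̄·B_i two-point mean squares of I3-N type) + I3-E at `1 − w̄` +
I3-B·e^{−2c𝓛¹⁰}"): by the REFLECTED Lemma 6.1 (`Section6Statements.lemma61_reflected`, a tree theorem
under (A)) `L(w) = K(w,ψ) + Z(w,ψ)N(1−w,ψ̄) + O(E₁(1−w̄,ψ) + e^{−c𝓛¹⁰})` on `|Re w − ½| < 2α`,
`|Im w − 2πt₀| < 𝓛₁ + 2`; `|Z(w,ψ)| ≤ e¹⁶` there (`Section6Statements.norm_Zfac_le_exp_sixteen`);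
`|N(1−w,ψ̄)| = |N(1−w̄,ψ)|` (`conj_Nchar_bar`); and `(a+b+c+d)² ≤ 4(a²+b²+c²+d²)`. Hence

* `meanSq_L_mul_B1_le_of` — from the four mean values (hypotheses, each in the scratch shape: K·B₁
  and N·B₁ two-point [I3-N type], E₁²·|B₁|² [closer-2's `meanSq_E1main_mul_B1_le_of` output shape,
  `𝓛^{kD+30}/𝓛¹³⁶`], |B₁|² [I3-B₁]) to **I3-L₁**: under (A),
  `Σ_{ψ∈T} |L(w,ψ)(H₁₄+ι₂H₁₂)(s,ψ)|² ≤ C·P²·𝓛^{max(kK,kN,kD+30,kB)}` for `|Re s − ½| ≤ 2α`,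
  `|Re w − ½| ≤ α`, `|Im w − 2πt₀| ≤ 𝓛₁ + 1`;
* `meanSq_L_mul_B2_le_of` — the same with `B₂ = H₂`.

Both are stated for a GENERIC factor `F x s` first (`meanSq_L_mul_le_of`), then specialised. No new
definitions, no new named facts; the K·B inputs ("I3-K", same proof as I3-N with `P₄` for `T²`) are
flagged for the I3-N owner. NOT here: the mean values themselves, (13.11), Theorems 1–2, zeros.

## References

* Y. Zhang, arXiv:2211.02515v1 (2022), §13 (13.11) p. 75, tex L3806–L3817; §6 Lemma 6.1 p. 31; §8
  p. 44 (the printed parallel "by Lemma 6.1 and the large sieve inequality").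
  [cite: Zhang2022LandauSiegel, §13 (13.11) p.75; §6 Lemma 6.1]
-/

noncomputable section

open Complex Real ComplexConjugate

namespace Literature.NumberTheory.LFunctions.Zhang2022.Typed.Section13

open Skeleton GammaFactor

/-- `(a+b+c+d)² ≤ 4(a²+b²+c²+d²)`. [folklore] -/
private theorem sq_add_four_le (a b c d : ℝ) :
    (a + b + c + d) ^ 2 ≤ 4 * (a ^ 2 + b ^ 2 + c ^ 2 + d ^ 2) := by
  nlinarith [sq_nonneg (a - b), sq_nonneg (a - c), sq_nonneg (a - d), sq_nonneg (b - c),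
    sq_nonneg (b - d), sq_nonneg (c - d)]

/-- `𝔓 = Σ_{p∼P} p ≤ 6P²` (at most `3P` members, each `≤ 2P`; `𝓛 ≥ 1`). [folklore] -/
private theorem frakP_le_six {D : ℕ} (hL1 : 1 ≤ ell D) : frakP D ≤ 6 * bigP D ^ 2 := by
  have hP0 : 0 < bigP D := Real.exp_pos _
  rw [frakP_eq_sum_primeWindow]
  have hcard : ((primeWindow D).card : ℝ) ≤ 3 * bigP D := by
    have hℓ : (ell D ^ 68)⁻¹ ≤ 1 := inv_le_one_of_one_le₀ (one_le_pow₀ hL1)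
    have h1 : (primeWindow D).card ≤ ⌈bigP D * (1 + (ell D ^ 68)⁻¹)⌉₊ := by
      unfold primeWindow
      refine (Finset.card_filter_le _ _).trans ?_
      rw [Nat.card_Ioo]; omega
    have h2 : (⌈bigP D * (1 + (ell D ^ 68)⁻¹)⌉₊ : ℝ) < bigP D * (1 + (ell D ^ 68)⁻¹) + 1 :=
      Nat.ceil_lt_add_one (by positivity)
    have h3 : bigP D * (1 + (ell D ^ 68)⁻¹) ≤ 2 * bigP D := by nlinarith
    have h1' : ((primeWindow D).card : ℝ) ≤ ⌈bigP D * (1 + (ell D ^ 68)⁻¹)⌉₊ := by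
      exact_mod_cast h1
    have hP1 : 1 ≤ bigP D := Real.one_le_exp (by positivity)
    linarith
  calc ∑ p ∈ primeWindow D, (p : ℝ) ≤ ∑ p ∈ primeWindow D, 2 * bigP D :=
        Finset.sum_le_sum fun p hp => le_two_mul_bigP_of_mem_primeWindow hL1 hp
    _ = (primeWindow D).card * (2 * bigP D) := by rw [Finset.sum_const, nsmul_eq_mul]
    _ ≤ 3 * bigP D * (2 * bigP D) := by gcongr
    _ = 6 * bigP D ^ 2 := by ring

/-- **Pointwise step** (Lemma 6.1 reflected + `|Z| ≤ e¹⁶` + `|N(1−w,ψ̄)| = |N(1−w̄,ψ)|`): for `ψ ∈ Ψ`,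
`𝓛 ≥ 3`, `w = σ + it` with `|σ − ½| ≤ 2α`, `|t − 2πt₀| < 𝓛₁ + 2`, any `F`, and the Lemma-6.1 remainder
bound `‖L(w) − K(w) − Z(w)N(1−w,ψ̄)‖ ≤ C′(E₁(1−w̄) + ε)` (`ε ≤ 1`, `0 ≤ C′`):
`|L(w)F|² ≤ 4(|K(w)F|² + e³²|N(1−w̄,ψ)F|² + C′²E₁(1−w̄)²|F|² + C′²|F|²)`.
[cite: Zhang2022LandauSiegel, §6 Lemma 6.1 p.31; §13 p.75] -/
theorem norm_L_mul_sq_le {D : ℕ} (x : Chr D) (hL : 3 ≤ ell D) {w : ℂ} {σ t C' ε : ℝ} (F : ℂ)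
    (hre : w.re = σ) (him : w.im = t) (hσ : |σ - 1 / 2| ≤ 2 * alpha D)
    (ht : |t - 2 * π * ell D ^ 519| < ell D ^ 405 + 2) (hC' : 0 ≤ C') (hε1 : ε ≤ 1)
    (h61 : ‖x.ψ.LFunction w - Kchar D (psiFn x) w -
        Zfac x.ψ w * Nchar D (psiBarFn x) (1 - w)‖ ≤ C' * (E1main x (1 - conj w) + ε)) :
    ‖x.ψ.LFunction w * F‖ ^ 2 ≤
      4 * (‖Kchar D (psiFn x) w * F‖ ^ 2 + Real.exp 32 * ‖Nchar D (psiFn x) (1 - conj w) * F‖ ^ 2 +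
        C' ^ 2 * (E1main x (1 - conj w) ^ 2 * ‖F‖ ^ 2) + C' ^ 2 * ‖F‖ ^ 2) := by
  have hs : w = (σ : ℂ) + t * I := Complex.ext (by simp [hre]) (by simp [him])
  have hZle : ‖Zfac x.ψ w‖ ≤ Real.exp 16 := by
    rw [hs]; exact Section6Statements.norm_Zfac_le_exp_sixteen x hL hσ ht
  have hE0 : 0 ≤ E1main x (1 - conj w) := E1main_nonneg x _
  have hN : ‖Zfac x.ψ w * Nchar D (psiBarFn x) (1 - w)‖ ≤
      Real.exp 16 * ‖Nchar D (psiFn x) (1 - conj w)‖ := by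
    rw [norm_mul, ← Complex.norm_conj (Nchar D (psiBarFn x) (1 - w)), conj_Nchar_bar, map_sub,
      map_one]
    exact mul_le_mul_of_nonneg_right hZle (norm_nonneg _)
  have h2 : ‖x.ψ.LFunction w‖ ≤ ‖Kchar D (psiFn x) w‖ +
      Real.exp 16 * ‖Nchar D (psiFn x) (1 - conj w)‖ + C' * E1main x (1 - conj w) + C' := by
    have h3 : x.ψ.LFunction w =
        (x.ψ.LFunction w - Kchar D (psiFn x) w - Zfac x.ψ w * Nchar D (psiBarFn x) (1 - w)) +
          Kchar D (psiFn x) w + Zfac x.ψ w * Nchar D (psiBarFn x) (1 - w) := by ring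
    calc ‖x.ψ.LFunction w‖
        = ‖(x.ψ.LFunction w - Kchar D (psiFn x) w - Zfac x.ψ w * Nchar D (psiBarFn x) (1 - w)) +
            Kchar D (psiFn x) w + Zfac x.ψ w * Nchar D (psiBarFn x) (1 - w)‖ := by rw [← h3]
      _ ≤ ‖x.ψ.LFunction w - Kchar D (psiFn x) w - Zfac x.ψ w * Nchar D (psiBarFn x) (1 - w)‖ +
            ‖Kchar D (psiFn x) w‖ + ‖Zfac x.ψ w * Nchar D (psiBarFn x) (1 - w)‖ := norm_add₃_le
      _ ≤ C' * (E1main x (1 - conj w) + ε) + ‖Kchar D (psiFn x) w‖ +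
            Real.exp 16 * ‖Nchar D (psiFn x) (1 - conj w)‖ := by gcongr
      _ ≤ _ := by nlinarith [mul_le_mul_of_nonneg_left hε1 hC']
  have hF0 : 0 ≤ ‖F‖ := norm_nonneg _
  have h4 : ‖x.ψ.LFunction w * F‖ ≤ ‖Kchar D (psiFn x) w * F‖ +
      Real.exp 16 * ‖Nchar D (psiFn x) (1 - conj w) * F‖ +
        C' * (E1main x (1 - conj w) * ‖F‖) + C' * ‖F‖ := by
    rw [norm_mul, norm_mul, norm_mul]
    have := mul_le_mul_of_nonneg_right h2 hF0
    nlinarith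
  have hA0 : 0 ≤ ‖Kchar D (psiFn x) w * F‖ := norm_nonneg _
  have hB0 : 0 ≤ Real.exp 16 * ‖Nchar D (psiFn x) (1 - conj w) * F‖ := by positivity
  have hC0 : 0 ≤ C' * (E1main x (1 - conj w) * ‖F‖) := by positivity
  have hD0 : 0 ≤ C' * ‖F‖ := by positivity
  have hLF0 : 0 ≤ ‖x.ψ.LFunction w * F‖ := norm_nonneg _
  have h5 : ‖x.ψ.LFunction w * F‖ ^ 2 ≤ (‖Kchar D (psiFn x) w * F‖ +
      Real.exp 16 * ‖Nchar D (psiFn x) (1 - conj w) * F‖ +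
        C' * (E1main x (1 - conj w) * ‖F‖) + C' * ‖F‖) ^ 2 :=
    pow_le_pow_left₀ hLF0 h4 2
  refine h5.trans ((sq_add_four_le _ _ _ _).trans (le_of_eq ?_))
  have he : Real.exp 16 ^ 2 = Real.exp 32 := by rw [← Real.exp_nat_mul]; norm_num
  rw [mul_pow, mul_pow, mul_pow, mul_pow, he]

/-- **I3-L, generic factor: the mean value of `L(w,ψ)·F(ψ)` from the four mean values.** Under (A), for
all large `D`: if on a finite `T ⊆ Ψ` and for given `w` (`|Re w − ½| ≤ α`, `|Im w − 2πt₀| ≤ 𝓛₁ + 1`)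
and factor `F : Chr D → ℂ` one has `Σ|K(w)F|² ≤ M_K`, `Σ|N(1−w̄,ψ)F|² ≤ M_N`, `Σ E₁(1−w̄)²|F|² ≤ M_E`,
`Σ|F|² ≤ M_B`, then `Σ_{ψ∈T}|L(w,ψ)F(ψ)|² ≤ 4(M_K + e³²M_N + C₆₁²M_E + C₆₁²M_B)` with the constant
`C₆₁` of the reflected Lemma 6.1. [cite: Zhang2022LandauSiegel, §6 Lemma 6.1 p.31; §13 (13.11) p.75] -/
theorem meanSq_L_mul_le_of_bounds :
    ∃ C₆₁ : ℝ, 0 ≤ C₆₁ ∧ ForAllLarge fun D _ χ => AssumptionA D χ →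
      ∀ (T : Finset (Chr D)) (w : ℂ) (F : Chr D → ℂ) (MK MN ME MB : ℝ),
        |w.re - 1 / 2| ≤ alpha D → |w.im - 2 * π * t0 D| ≤ ell1 D + 1 →
        (∑ x ∈ T, ‖Kchar D (psiFn x) w * F x‖ ^ 2 ≤ MK) →
        (∑ x ∈ T, ‖Nchar D (psiFn x) (1 - conj w) * F x‖ ^ 2 ≤ MN) →
        (∑ x ∈ T, E1main x (1 - conj w) ^ 2 * ‖F x‖ ^ 2 ≤ ME) →
        (∑ x ∈ T, ‖F x‖ ^ 2 ≤ MB) →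
          ∑ x ∈ T, ‖x.ψ.LFunction w * F x‖ ^ 2 ≤
            4 * (MK + Real.exp 32 * MN + C₆₁ ^ 2 * ME + C₆₁ ^ 2 * MB) := by
  obtain ⟨c, hc, C, D₀, h61⟩ := Section6Statements.lemma61_reflected
  obtain ⟨D₃, hℓ3⟩ := exists_nat_forall_le_ell 3
  refine ⟨max C 0, le_max_right _ _, max D₀ D₃,
    fun D _ χ hD hq hp hA T w F MK MN ME MB hwre hwim hK hN hE hB => ?_⟩
  have hD₀ : D₀ ≤ D := le_trans (le_max_left _ _) hD
  have hL3 : 3 ≤ ell D := hℓ3 D (le_trans (le_max_right _ _) hD)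
  have hL1 : 1 ≤ ell D := by linarith
  have hα : 0 < alpha D := by
    rw [alpha, bigP, Real.log_exp]; positivity
  set ε : ℝ := Real.exp (-c * ell D ^ 10) with hε
  have hε0 : 0 ≤ ε := (Real.exp_pos _).le
  have hε1 : ε ≤ 1 := by
    rw [hε]; exact Real.exp_le_one_iff.mpr (by
      have : 0 ≤ ell D ^ 10 := by positivity
      nlinarith)
  -- pointwise: every `ψ ∈ T`
  have hpt : ∀ x ∈ T, ‖x.ψ.LFunction w * F x‖ ^ 2 ≤
      4 * (‖Kchar D (psiFn x) w * F x‖ ^ 2 +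
        Real.exp 32 * ‖Nchar D (psiFn x) (1 - conj w) * F x‖ ^ 2 +
        (max C 0) ^ 2 * (E1main x (1 - conj w) ^ 2 * ‖F x‖ ^ 2) + (max C 0) ^ 2 * ‖F x‖ ^ 2) := by
    intro x _
    have hwre' : |w.re - 1 / 2| < 2 * alpha D := by linarith
    have hwim' : |w.im - 2 * π * t0 D| < ell1 D + 2 := by linarith
    have h1 := h61 D χ hD₀ hq hp hA x w hwre' hwim'
    have h1' : ‖x.ψ.LFunction w - Kchar D (psiFn x) w - Zfac x.ψ w * Nchar D (psiBarFn x) (1 - w)‖ ≤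
        max C 0 * (E1main x (1 - (starRingEnd ℂ) w) + ε) := by
      refine h1.trans (mul_le_mul_of_nonneg_right (le_max_left _ _) ?_)
      exact add_nonneg (E1main_nonneg x _) hε0
    have hσ : |w.re - 1 / 2| ≤ 2 * alpha D := hwre'.le
    have ht : |w.im - 2 * π * ell D ^ 519| < ell D ^ 405 + 2 := by
      rw [t0, ell1] at *; exact hwim'
    exact norm_L_mul_sq_le x hL3 (F x) rfl rfl hσ ht (le_max_right _ _) hε1 h1'
  calc ∑ x ∈ T, ‖x.ψ.LFunction w * F x‖ ^ 2
      ≤ ∑ x ∈ T, 4 * (‖Kchar D (psiFn x) w * F x‖ ^ 2 +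
          Real.exp 32 * ‖Nchar D (psiFn x) (1 - conj w) * F x‖ ^ 2 +
          (max C 0) ^ 2 * (E1main x (1 - conj w) ^ 2 * ‖F x‖ ^ 2) + (max C 0) ^ 2 * ‖F x‖ ^ 2) :=
        Finset.sum_le_sum hpt
    _ = 4 * (∑ x ∈ T, ‖Kchar D (psiFn x) w * F x‖ ^ 2 +
          Real.exp 32 * ∑ x ∈ T, ‖Nchar D (psiFn x) (1 - conj w) * F x‖ ^ 2 +
          (max C 0) ^ 2 * ∑ x ∈ T, E1main x (1 - conj w) ^ 2 * ‖F x‖ ^ 2 +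
          (max C 0) ^ 2 * ∑ x ∈ T, ‖F x‖ ^ 2) := by
        rw [← Finset.mul_sum, Finset.sum_add_distrib, Finset.sum_add_distrib, Finset.sum_add_distrib,
          ← Finset.mul_sum, ← Finset.mul_sum, ← Finset.mul_sum]
    _ ≤ 4 * (MK + Real.exp 32 * MN + (max C 0) ^ 2 * ME + (max C 0) ^ 2 * MB) := by
        gcongr

/-! ## I3-L in the programme's shapes: from the four `P²𝓛^k` mean values -/

/-- **I3-L, generic `B`-factor, in the WP14 §13 programme shapes**: for any family of factors
`G χ ψ s` (instances: `B₁ = H₁₄ + ι₂H₁₂`, `B₂ = H₂`), the four eventual mean-value bounds —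
`Σ|K(w)G(s)|² ≤ C·P²𝓛^{kK}` (large-sieve form: `K·B_i` has length `> P`) and, in the 𝔓-form of the
signature scratch v3, `Σ|N(w,ψ)G(s)|² ≤ C·𝔓𝓛^{kN}` for `s, w` in the strip `|σ − ½| ≤ 2α` (two-point
form, I3-N type), `Σ E₁(w)²|G(s)|² ≤ C·𝔓𝓛^{kD+30}/𝓛¹³⁶` (I3-E shape) and `Σ|G(s)|² ≤ C·𝔓𝓛^{kB}` (I3-B
shape; `𝔓 ≤ 6P²` trivially) — imply, under (A), for `|Re s − ½| ≤ 2α`, `|Re w − ½| ≤ α`,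
`|Im w − 2πt₀| ≤ 𝓛₁ + 1`: `Σ_{ψ∈T}|L(w,ψ)G(s)|² ≤ C·P²·𝓛^{max(kK,kN,kD+30,kB)}` (the N- and E₁-inputs are
used at the reflected point `1 − w̄`, which lies in the strip).
[cite: Zhang2022LandauSiegel, §13 (13.11) p.75; §6 Lemma 6.1 p.31] -/
theorem meanSq_L_mul_le_of (G : ∀ (D : ℕ) [NeZero D], DirichletCharacter ℂ D → Chr D → ℂ → ℂ)
    (kK kN kD kB : ℕ)
    (hK : ∃ C : ℝ, 0 ≤ C ∧ ForAllLarge fun D _ χ =>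
      ∀ (T : Finset (Chr D)) (s w : ℂ), |s.re - 1 / 2| ≤ 2 * alpha D → |w.re - 1 / 2| ≤ 2 * alpha D →
        ∑ x ∈ T, ‖Kchar D (psiFn x) w * G D χ x s‖ ^ 2 ≤ C * bigP D ^ 2 * ell D ^ kK)
    (hN : ∃ C : ℝ, 0 ≤ C ∧ ForAllLarge fun D _ χ =>
      ∀ (T : Finset (Chr D)) (s w : ℂ), |s.re - 1 / 2| ≤ 2 * alpha D → |w.re - 1 / 2| ≤ 2 * alpha D →
        ∑ x ∈ T, ‖Nchar D (psiFn x) w * G D χ x s‖ ^ 2 ≤ C * frakP D * ell D ^ kN)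
    (hE : ∃ C : ℝ, 0 ≤ C ∧ ForAllLarge fun D _ χ =>
      ∀ (T : Finset (Chr D)) (s w : ℂ), |s.re - 1 / 2| ≤ 2 * alpha D → |w.re - 1 / 2| ≤ 2 * alpha D →
        ∑ x ∈ T, E1main x w ^ 2 * ‖G D χ x s‖ ^ 2 ≤
          C * frakP D * ell D ^ (kD + 30) / ell D ^ 136)
    (hB : ∃ C : ℝ, 0 ≤ C ∧ ForAllLarge fun D _ χ =>
      ∀ (T : Finset (Chr D)) (s : ℂ), |s.re - 1 / 2| ≤ 2 * alpha D →
        ∑ x ∈ T, ‖G D χ x s‖ ^ 2 ≤ C * frakP D * ell D ^ kB) :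
    ∃ C : ℝ, 0 ≤ C ∧ ForAllLarge fun D _ χ => AssumptionA D χ →
      ∀ (T : Finset (Chr D)) (s w : ℂ), |s.re - 1 / 2| ≤ 2 * alpha D →
        |w.re - 1 / 2| ≤ alpha D → |w.im - 2 * π * t0 D| ≤ ell1 D + 1 →
          ∑ x ∈ T, ‖x.ψ.LFunction w * G D χ x s‖ ^ 2 ≤
            C * bigP D ^ 2 * ell D ^ (max (max kK kN) (max (kD + 30) kB)) := by
  obtain ⟨CK, hCK, hK⟩ := hK
  obtain ⟨CN, hCN, hN⟩ := hN
  obtain ⟨CE, hCE, hE⟩ := hE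
  obtain ⟨CB, hCB, hB⟩ := hB
  obtain ⟨C61, hC61, hL⟩ := meanSq_L_mul_le_of_bounds
  obtain ⟨D₁, hℓ1⟩ := exists_nat_forall_le_ell 1
  obtain ⟨D₀, hall⟩ := (((hK.and hN).and hE).and hB).and hL
  set k : ℕ := max (max kK kN) (max (kD + 30) kB) with hk
  refine ⟨4 * (CK + Real.exp 32 * (6 * CN) + C61 ^ 2 * (6 * CE) + C61 ^ 2 * (6 * CB)), by positivity,
    max D₀ D₁, fun D _ χ hD hq hp hA T s w hs hwre hwim => ?_⟩
  obtain ⟨⟨⟨⟨hKD, hND⟩, hED⟩, hBD⟩, hLD⟩ := hall D χ (le_trans (le_max_left _ _) hD) hq hp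
  have hL1 : 1 ≤ ell D := hℓ1 D (le_trans (le_max_right _ _) hD)
  have hP4' : frakP D ≤ 6 * bigP D ^ 2 := frakP_le_six hL1
  have hα : 0 ≤ alpha D := by rw [alpha, bigP, Real.log_exp]; positivity
  have hwre2 : |w.re - 1 / 2| ≤ 2 * alpha D := by linarith
  -- the reflected point `w' = 1 − w̄` lies in the strip
  have hw' : |(1 - (starRingEnd ℂ) w).re - 1 / 2| ≤ 2 * alpha D := by
    have : (1 - (starRingEnd ℂ) w).re - 1 / 2 = -(w.re - 1 / 2) := by simp; ring
    rw [this, abs_neg]; exact hwre2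
  have h1 := hLD hA T w (fun x => G D χ x s) _ _ _ _ hwre hwim (hKD T s w hs hwre2)
    (hND T s _ hs hw') (hED T s _ hs hw') (hBD T s hs)
  refine h1.trans ?_
  -- every `𝓛`-power is `≤ 𝓛^k`, and `𝓛^{kD+30}/𝓛¹³⁶ ≤ 𝓛^{kD+30}`
  have hP2 : 0 ≤ bigP D ^ 2 := sq_nonneg _
  have hpow : ∀ j : ℕ, j ≤ k → ell D ^ j ≤ ell D ^ k := fun j hj => pow_le_pow_right₀ hL1 hj
  have hKk : CK * bigP D ^ 2 * ell D ^ kK ≤ CK * bigP D ^ 2 * ell D ^ k :=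
    mul_le_mul_of_nonneg_left (hpow kK (by omega)) (by positivity)
  have hfP0 : 0 ≤ frakP D := by
    rw [frakP_eq_sum_primeWindow]; exact Finset.sum_nonneg fun p _ => Nat.cast_nonneg p
  have hNk : CN * frakP D * ell D ^ kN ≤ 6 * CN * bigP D ^ 2 * ell D ^ k := by
    calc CN * frakP D * ell D ^ kN ≤ CN * (6 * bigP D ^ 2) * ell D ^ k :=
          mul_le_mul (mul_le_mul_of_nonneg_left hP4' hCN) (hpow kN (by omega)) (by positivity)
            (by positivity)
      _ = 6 * CN * bigP D ^ 2 * ell D ^ k := by ring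
  have hEk : CE * frakP D * ell D ^ (kD + 30) / ell D ^ 136 ≤ 6 * CE * bigP D ^ 2 * ell D ^ k := by
    have h136 : 1 ≤ ell D ^ 136 := one_le_pow₀ hL1
    calc CE * frakP D * ell D ^ (kD + 30) / ell D ^ 136 ≤ CE * frakP D * ell D ^ (kD + 30) :=
          div_le_self (by positivity) h136
      _ ≤ CE * (6 * bigP D ^ 2) * ell D ^ k :=
          mul_le_mul (mul_le_mul_of_nonneg_left hP4' hCE) (hpow _ (by omega)) (by positivity)
            (by positivity)
      _ = 6 * CE * bigP D ^ 2 * ell D ^ k := by ring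
  have hBk : CB * frakP D * ell D ^ kB ≤ 6 * CB * bigP D ^ 2 * ell D ^ k := by
    calc CB * frakP D * ell D ^ kB ≤ CB * (6 * bigP D ^ 2) * ell D ^ k :=
          mul_le_mul (mul_le_mul_of_nonneg_left hP4' hCB) (hpow kB (by omega)) (by positivity)
            (by positivity)
      _ = 6 * CB * bigP D ^ 2 * ell D ^ k := by ring
  have he32 : 0 ≤ Real.exp 32 := (Real.exp_pos _).le
  have hC2 : 0 ≤ C61 ^ 2 := sq_nonneg _
  calc 4 * (CK * bigP D ^ 2 * ell D ^ kK + Real.exp 32 * (CN * frakP D * ell D ^ kN) +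
        C61 ^ 2 * (CE * frakP D * ell D ^ (kD + 30) / ell D ^ 136) +
        C61 ^ 2 * (CB * frakP D * ell D ^ kB))
      ≤ 4 * (CK * bigP D ^ 2 * ell D ^ k + Real.exp 32 * (6 * CN * bigP D ^ 2 * ell D ^ k) +
        C61 ^ 2 * (6 * CE * bigP D ^ 2 * ell D ^ k) + C61 ^ 2 * (6 * CB * bigP D ^ 2 * ell D ^ k)) := by
        gcongr
    _ = 4 * (CK + Real.exp 32 * (6 * CN) + C61 ^ 2 * (6 * CE) + C61 ^ 2 * (6 * CB)) *
          bigP D ^ 2 * ell D ^ k := by ring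

/-- **I3-L₁** (scratch `meanSq_L_mul_B1_le`, from its four inputs): under (A), for `|Re s − ½| ≤ 2α`,
`|Re w − ½| ≤ α`, `|Im w − 2πt₀| ≤ 𝓛₁ + 1`,
`Σ_{ψ∈T} |L(w,ψ)·(H₁₄ + ι₂H₁₂)(s,ψ)|² ≤ C·P²·𝓛^{max(kK,kN,kD+30,kB)}` — given the K·B₁ and N·B₁
two-point mean values (I3-N₁ type; the K-twin has the same proof with `P₄` for `T²`), I3-E₁
(`meanSq_E1main_mul_B1_le_of`'s conclusion) and I3-B₁. [cite: Zhang2022LandauSiegel, §13 (13.11) p.75; §6 Lemma 6.1] -/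
theorem meanSq_L_mul_B1_le_of (kK kN kD kB : ℕ)
    (hK : ∃ C : ℝ, 0 ≤ C ∧ ForAllLarge fun D _ χ =>
      ∀ (T : Finset (Chr D)) (s w : ℂ), |s.re - 1 / 2| ≤ 2 * alpha D → |w.re - 1 / 2| ≤ 2 * alpha D →
        ∑ x ∈ T, ‖Kchar D (psiFn x) w * (H14 χ x s + iota2 * H12 χ x s)‖ ^ 2 ≤
          C * bigP D ^ 2 * ell D ^ kK)
    (hN : ∃ C : ℝ, 0 ≤ C ∧ ForAllLarge fun D _ χ =>
      ∀ (T : Finset (Chr D)) (s w : ℂ), |s.re - 1 / 2| ≤ 2 * alpha D → |w.re - 1 / 2| ≤ 2 * alpha D →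
        ∑ x ∈ T, ‖Nchar D (psiFn x) w * (H14 χ x s + iota2 * H12 χ x s)‖ ^ 2 ≤
          C * frakP D * ell D ^ kN)
    (hE : ∃ C : ℝ, 0 ≤ C ∧ ForAllLarge fun D _ χ =>
      ∀ (T : Finset (Chr D)) (s w : ℂ), |s.re - 1 / 2| ≤ 2 * alpha D → |w.re - 1 / 2| ≤ 2 * alpha D →
        ∑ x ∈ T, E1main x w ^ 2 * ‖H14 χ x s + iota2 * H12 χ x s‖ ^ 2 ≤
          C * frakP D * ell D ^ (kD + 30) / ell D ^ 136)
    (hB : ∃ C : ℝ, 0 ≤ C ∧ ForAllLarge fun D _ χ =>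
      ∀ (T : Finset (Chr D)) (s : ℂ), |s.re - 1 / 2| ≤ 2 * alpha D →
        ∑ x ∈ T, ‖H14 χ x s + iota2 * H12 χ x s‖ ^ 2 ≤ C * frakP D * ell D ^ kB) :
    ∃ C : ℝ, 0 ≤ C ∧ ForAllLarge fun D _ χ => AssumptionA D χ →
      ∀ (T : Finset (Chr D)) (s w : ℂ), |s.re - 1 / 2| ≤ 2 * alpha D →
        |w.re - 1 / 2| ≤ alpha D → |w.im - 2 * π * t0 D| ≤ ell1 D + 1 →
          ∑ x ∈ T, ‖x.ψ.LFunction w * (H14 χ x s + iota2 * H12 χ x s)‖ ^ 2 ≤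
            C * bigP D ^ 2 * ell D ^ (max (max kK kN) (max (kD + 30) kB)) :=
  meanSq_L_mul_le_of (fun _ _ χ x s => H14 χ x s + iota2 * H12 χ x s) kK kN kD kB hK hN hE hB

/-- **I3-L₂** (scratch `meanSq_L_mul_B2_le`): the same with `B₂ = H₂`.
[cite: Zhang2022LandauSiegel, §13 (13.11) p.75; §6 Lemma 6.1] -/
theorem meanSq_L_mul_B2_le_of (kK kN kD kB : ℕ)
    (hK : ∃ C : ℝ, 0 ≤ C ∧ ForAllLarge fun D _ χ =>
      ∀ (T : Finset (Chr D)) (s w : ℂ), |s.re - 1 / 2| ≤ 2 * alpha D → |w.re - 1 / 2| ≤ 2 * alpha D →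
        ∑ x ∈ T, ‖Kchar D (psiFn x) w * H2 χ x s‖ ^ 2 ≤ C * bigP D ^ 2 * ell D ^ kK)
    (hN : ∃ C : ℝ, 0 ≤ C ∧ ForAllLarge fun D _ χ =>
      ∀ (T : Finset (Chr D)) (s w : ℂ), |s.re - 1 / 2| ≤ 2 * alpha D → |w.re - 1 / 2| ≤ 2 * alpha D →
        ∑ x ∈ T, ‖Nchar D (psiFn x) w * H2 χ x s‖ ^ 2 ≤ C * frakP D * ell D ^ kN)
    (hE : ∃ C : ℝ, 0 ≤ C ∧ ForAllLarge fun D _ χ =>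
      ∀ (T : Finset (Chr D)) (s w : ℂ), |s.re - 1 / 2| ≤ 2 * alpha D → |w.re - 1 / 2| ≤ 2 * alpha D →
        ∑ x ∈ T, E1main x w ^ 2 * ‖H2 χ x s‖ ^ 2 ≤
          C * frakP D * ell D ^ (kD + 30) / ell D ^ 136)
    (hB : ∃ C : ℝ, 0 ≤ C ∧ ForAllLarge fun D _ χ =>
      ∀ (T : Finset (Chr D)) (s : ℂ), |s.re - 1 / 2| ≤ 2 * alpha D →
        ∑ x ∈ T, ‖H2 χ x s‖ ^ 2 ≤ C * frakP D * ell D ^ kB) :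
    ∃ C : ℝ, 0 ≤ C ∧ ForAllLarge fun D _ χ => AssumptionA D χ →
      ∀ (T : Finset (Chr D)) (s w : ℂ), |s.re - 1 / 2| ≤ 2 * alpha D →
        |w.re - 1 / 2| ≤ alpha D → |w.im - 2 * π * t0 D| ≤ ell1 D + 1 →
          ∑ x ∈ T, ‖x.ψ.LFunction w * H2 χ x s‖ ^ 2 ≤
            C * bigP D ^ 2 * ell D ^ (max (max kK kN) (max (kD + 30) kB)) :=
  meanSq_L_mul_le_of (fun _ _ χ x s => H2 χ x s) kK kN kD kB hK hN hE hB

end Literature.NumberTheory.LFunctions.Zhang2022.Typed.Section13
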